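import Summits.BirchSwinnertonDyer.Uniform.U2.GenusTwistSignLaw
import Summits.BirchSwinnertonDyer.Uniform.U2.RouteBRankDichotomy
import HarnessLib

/-!
# Cell «bsd-uniform», track U2, ROUTE B — the `h_∞` RANK TABLE of the genus pair, flips included,
# on the class `Tam(E)` odd (sign law with `hsq` discharged) from the single analytic binder `hGZ`

HONEST FRAMING (cell «bsd-uniform», HOME `run/shared/lean/pub/bsd-uniform/`, seat u2-p2). What this
file IS: the composition of the landed `RouteBRankDichotomy.rank_genusPair_dichotomy_of_models` (Thm A′
shape from `hGZ = L′(1,E,χ) ≠ 0`) with the landed sign law of `GenusTwistSignLaw` (§5: `Δ := Δ_min`,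
`hsq` discharged on `Tam(E)` odd, resolvent hypothesis `hres` typed) into the `h_∞` TABLE of T4-PROOF
Remark 4.2/4.2′ INCLUDING THE FLIPS (R-T4-5: "on the flip half `h_∞ = 1` the route delivers ranks
only"): `r_an(E^{(d)}) = r_an(E)` and `r_an(E^{(dD)}) = 1 − r_an(E)` if `¬(Δ_min > 0 ∧ d < 0)`, and the
two swapped if `Δ_min > 0 ∧ d < 0`; Mordell–Weil ranks equal analytic ranks and `Ш` is finite for
both twists (GZK). What it is NOT: no binder is discharged beyond `hsq`; nothing booked; flips carry NO
`BSD(·,2)` statement (Zhai needs `h_∞ = 0`, RESIDUE R2-4).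

References: `p2/idea-2/T4-PROOF.md` v1.9b Remarks 4.2, 4.2′, 7.1 (R-T4-5); Kriz–Li 2019 Thm. 3.3,
Cor. 5.2, Example 6.1 [KrizLi2019]; Silverman ATAEC IV.9.4 / IV.11.1 [SilvermanATAEC1994].
-/

noncomputable section

open scoped Classical NumberTheorySymbols

open WeierstrassCurve Literature.NumberTheory.EllipticCurves
  Literature.NumberTheory.EllipticCurves.ModularForms

namespace Summit.BirchSwinnertonDyer.Uniform.U2

/-- **ROUTE B RANK TABLE (flips included) on the class `Tam(E)` odd.** For a globally minimal elliptic
`W/ℚ` with `∏ c_ℓ` odd and `r_an(E) ≤ 1`; `d ≡ D ≡ 1 (mod 4)`, `dD` squarefree prime to `N`,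
`χ_D(−N) = −1` (Heegner); every prime `q ∣ d` with `q ∤ N·Δ_min` and `J(Δ_min | q) = 1` (`a_q` odd:
resolvent hypothesis, typed); Modularity / parity / GZK named facts; and the ONE analytic binder
`hGZ : L′(1, E, χ) ≠ 0`: on any models `W₁ ≅ E^{(d)}`, `W₂ ≅ E^{(dD)}` the rank part of BSD holds with
finite `Ш`, and with `flip := (Δ_min > 0 ∧ d < 0)`:
`¬flip → r_an(W₁) = r_an(E) ∧ r_an(W₂) = 1 − r_an(E)`, `flip → r_an(W₁) = 1 − r_an(E) ∧ r_an(W₂) = r_an(E)`.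
[cite: KrizLi2019, Thm. 3.3 and Cor. 5.2 (shape; split primes, (★))]
[cite: SilvermanATAEC1994, IV.9.4 Table 4.1 and IV.11.1 (hsq via Tam odd)] -/
theorem rank_genusPair_table_of_odd_tamagawaProduct (W : WeierstrassCurve ℚ) [W.IsElliptic]
    [W.IsGloballyMinimal] (hmod : exists_isNewformOf) (hE : hasEntireLFunction_rat)
    (hpar : ∀ V : WeierstrassCurve ℚ, V.even_analyticRank_iff)
    (hGZK : rank_eq_analyticRank_of_analyticRank_le_one)
    (hodd : Odd W.tamagawaProduct)
    {d D : ℤ} (hd4 : d % 4 = 1) (hD4 : D % 4 = 1) (hsq : Squarefree (d * D))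
    (hgcd : Int.gcd (d * D) (W.conductorNorm ℤ) = 1)
    (hχ : J(-1 | D.natAbs) * J((W.conductorNorm ℤ : ℤ) | D.natAbs) = -1)
    (hprimes : ∀ q : ℕ, q.Prime → q ∣ d.natAbs →
      ¬ (q : ℤ) ∣ (W.conductorNorm ℤ : ℤ) * minimalDiscriminantInt W ∧
        J(minimalDiscriminantInt W | q) = 1)
    (hr : W.analyticRank ≤ 1)
    (hGZ : deriv (fun s => (W.quadraticTwist (d : ℚ)).entireLFunction s *
        (W.quadraticTwist ((d * D : ℤ) : ℚ)).entireLFunction s) 1 ≠ 0)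
    (W₁ W₂ : WeierstrassCurve ℚ) [W₁.IsElliptic] [W₂.IsElliptic]
    (h₁ : ∃ C : VariableChange ℚ, C • W₁ = W.quadraticTwist (d : ℚ))
    (h₂ : ∃ C : VariableChange ℚ, C • W₂ = W.quadraticTwist ((d * D : ℤ) : ℚ)) :
    W₁.mordellWeilRank = W₁.analyticRank ∧ W₂.mordellWeilRank = W₂.analyticRank ∧
      Finite W₁.sha ∧ Finite W₂.sha ∧
      (¬ (0 < minimalDiscriminantInt W ∧ d < 0) →
        W₁.analyticRank = W.analyticRank ∧ W₂.analyticRank = 1 - W.analyticRank) ∧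
      ((0 < minimalDiscriminantInt W ∧ d < 0) →
        W₁.analyticRank = 1 - W.analyticRank ∧ W₂.analyticRank = W.analyticRank) := by
  obtain ⟨hm₁, hm₂, hf₁, hf₂, hdich, hiff⟩ :=
    rank_genusPair_dichotomy_of_models W hmod hE hpar hGZK hd4 hD4 hsq hgcd hχ hr hGZ W₁ W₂ h₁ h₂
  obtain ⟨hno, hflip⟩ :=
    analyticRank_table_of_dichotomy W W₁ W₂ (minimalDiscriminantInt_ne_zero W) hd4
      (isSquare_conductorNorm_mul_natAbs_minimalDiscriminantInt W hodd) hprimes hr ⟨hdich, hiff⟩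
  exact ⟨hm₁, hm₂, hf₁, hf₂, hno, hflip⟩

end Summit.BirchSwinnertonDyer.Uniform.U2

end
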